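/-
K2-LIT rung 3 ∕ (A) of ★ p855563 (prover seat hodgecm-mathlib-K2E1-p05, gen 2): THE `v`-FACTOR OF THE SIEGEL RADICAL AND THE ADELIC CUSP-VANISHING OF THE PURE TENSOR.
-/
import Summits.HodgeConjecture.HodgeConjecture.Theorems.K2E1SiegelRadicalCocompactU2             -- ★ p855616 (this seat): §1 `upperUnitriangular = 1 + 𝔫_1` at `N = 2`, transports; brings ★ p855468 §1
import Summits.HodgeConjecture.HodgeConjecture.Theorems.K2E1SupercuspidalUnipotentPeriodVanishing -- ★ p855530 (K2E1-p08): `hcu`, the local period vanishing of supercuspidal coefficients along `N_v`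
import Summits.HodgeConjecture.HodgeConjecture.Theorems.K2E1PoincareSeriesH1PackagePoincare       -- ★ p855494 (K2E1-p07): `awayFactor_mul_jhom_mul`, `toLocal_mul_jhom_mul` (the canonical `j_v`)
import Literature.NumberTheory.Automorphic.UnitaryGroupAdelicNormOneSockets                       -- ★ `isClosedEmbedding_inclPlaceAdelic`
import Literature.NumberTheory.Automorphic.LocalGLCongruenceBoxIwahori                            -- ★ `localGLPiEquiv_apply_apply`
import Literature.MeasureTheory.Group.InvariantQuotientAbelian                                    -- ★ `exists_smulInvariantMeasure_isFiniteMeasureOnCompacts_quotient_of_comm`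
import HarnessLib

/-!
# The `v`-factor of the Siegel radical of `U(Φ₂)` and hypothesis (A) of ★ p855563

ED. 2 of the 5R-supercuspidal chain, ★ p855563 `K2E1GlobaliseSupercuspidalU2Poincare.globaliseSupercuspidal_of_poincare`, carries two analytic binders on
the pure tensor `φ = c_u ⊗ 𝟙_{K^v} ⊗ f` of ★ p855494: (A) `∫_{N_i(𝔸)} φ(x n⁻¹ y) dn = 0` and (B) finite covolume.  (B) is ★ p855616; this file discharges
**(A) at `𝔓 := cmParabolicData L 2`** (the Siegel radical of `U(Φ₂)`), for `v` NON-SPLIT in `L` — the only case with supercuspidals in play here — from the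
local period vanishing of supercuspidal matrix coefficients (★ `K2E1SupercuspidalUnipotentPeriodVanishing`, K2E1-p08) by the subgroup unfolding of ★ p855468 §1
along the closed subgroup `H = j_v(N_v) ≤ N(𝔸)`.

## Contents
* §1 `jhom_mem_cmUnipotentRadical`: `j_v(N_v) ⊆ N(𝔸)` — the adelic matrix of `ι_v(u)` place by place (★ `UnitaryGroupPlaceInclusion`, ★ `UnitaryGroupRestrictedProduct`).
* §2 `mul_comm_cmUnipotentRadical` (★ `mul_comm_adelicUnipotent_two` transported), `isClosed_cmUnipotentRadical`.
* §3 **`integral_translate_inv_eq_zero_siegel`**: `∫_{N(𝔸)} φ(x n⁻¹ y) dν(n) = 0`.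
* §4 **`adelicCuspVanishing_cmParabolicData_two`** = binder `hA` of ★ p855563 at `(Φ₂, cmParabolicData L 2)`, token for token.
-/

set_option autoImplicit false

set_option linter.dupNamespace false

open MeasureTheory Filter Topology NumberField IsDedekindDomain
open scoped ENNReal Pointwise Classical
open Literature.NumberTheory.Automorphic Literature.NumberTheory.Automorphic.UnitaryGroup
open Summit.HodgeConjecture.HodgeConjecture.Cruxes.H413.K2E1CuspidalSpectrumUnitary (cmUnipotentRadical cmParabolicData)
open Summit.HodgeConjecture.HodgeConjecture.Cruxes.H413.K2E1SiegelRadicalCocompactU2 (upperUnitriangular_eq_standardUnipotentRadical_two)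

namespace Summit.HodgeConjecture.HodgeConjecture.Cruxes.H413.K2E1SiegelRadicalPlaceFactorU2

section PlaceFactor

variable (L : Type) [Field L] [NumberField L] [IsCMField L] (v : HeightOneSpectrum (𝓞 ↥(maximalRealSubfield L)))

/-- **`j_v` maps the local unipotent radical `N_v` into the adelic Siegel radical**: for `n ∈ N_v ≤ U(Φ₂)(L⁺_v)` (upper unitriangular local matrices) the
adelic matrix of `j_v(n) = ι_v(localPiEquiv⁻¹ n)` is upper unitriangular: its archimedean part is `1` (★ `map_fst_ofFinite`), its component at a finite place
`w ∣ v` is the `w`-component of `n` (★ `evalAt_inclPlace_of_over`, ★ `localGLPiEquiv_apply_apply`) and at `w ∤ v` it is `1` (★ `evalAt_inclPlace_of_not_over`).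
[cite: BorelJacquet1979, §4.1, §4.4] [cite: PlatonovRapinchuk1994, §5.1] -/
theorem jhom_mem_cmUnipotentRadical
    (n : ↥(unitaryGroupOfForm (conjLocal L (IsCMField.complexConj L) v) (cmLocalForm L 2 v))) (hn : n ∈ (cmBorelTriple L 2 v).N) :
    inclPlaceAdelic (↥(maximalRealSubfield L)) L (IsCMField.complexConj L) 2 (Matrix.of fun i j : Fin 2 => if i.val + j.val + 1 = 2 then (1 : L) else 0) v
        ((localPiEquiv L (IsCMField.complexConj L) 2 (Matrix.of fun i j : Fin 2 => if i.val + j.val + 1 = 2 then (1 : L) else 0) v).symm n) ∈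
      cmUnipotentRadical L 2 1 := by
  obtain ⟨htri, hdiag⟩ := (mem_unipotentU_iff (σ := conjLocal L (IsCMField.complexConj L) v) (J := cmLocalForm L 2 v) n).1 hn
  set u := (localPiEquiv L (IsCMField.complexConj L) 2 (Matrix.of fun i j : Fin 2 => if i.val + j.val + 1 = 2 then (1 : L) else 0) v).symm n with hu
  change adelicVal (↥(maximalRealSubfield L)) L (IsCMField.complexConj L) 2 (Matrix.of fun i j : Fin 2 => if i.val + j.val + 1 = 2 then (1 : L) else 0)
      (inclPlaceAdelic (↥(maximalRealSubfield L)) L (IsCMField.complexConj L) 2 (Matrix.of fun i j : Fin 2 => if i.val + j.val + 1 = 2 then (1 : L) else 0) v u) ∈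
    standardUnipotentRadical 2 1 (AdeleRing (𝓞 L) L)
  rw [← upperUnitriangular_eq_standardUnipotentRadical_two, mem_upperUnitriangular_iff]
  -- the adelic matrix of `ι_v(u)` is `GLn.ofFinite` of the finite-adelic matrix of `inclPlace v u`
  set g : GL (Fin 2) (FiniteAdeleRing (𝓞 L) L) :=
    ((inclPlace (↥(maximalRealSubfield L)) L (IsCMField.complexConj L) 2 (Matrix.of fun i j : Fin 2 => if i.val + j.val + 1 = 2 then (1 : L) else 0) v u :
      finAdelic (↥(maximalRealSubfield L)) L (IsCMField.complexConj L) 2 (Matrix.of fun i j : Fin 2 => if i.val + j.val + 1 = 2 then (1 : L) else 0)) :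
        GL (Fin 2) (FiniteAdeleRing (𝓞 L) L)) with hg
  have hM : adelicVal (↥(maximalRealSubfield L)) L (IsCMField.complexConj L) 2 (Matrix.of fun i j : Fin 2 => if i.val + j.val + 1 = 2 then (1 : L) else 0)
      (inclPlaceAdelic (↥(maximalRealSubfield L)) L (IsCMField.complexConj L) 2 (Matrix.of fun i j : Fin 2 => if i.val + j.val + 1 = 2 then (1 : L) else 0) v u) =
      GLn.ofFinite 2 L g := rfl
  have hfst : ((GLn.ofFinite 2 L g : GL (Fin 2) (AdeleRing (𝓞 L) L)) : Matrix (Fin 2) (Fin 2) (AdeleRing (𝓞 L) L)).map (adeleFst L) = 1 := map_fst_ofFinite L 2 g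
  have hsnd : ((GLn.ofFinite 2 L g : GL (Fin 2) (AdeleRing (𝓞 L) L)) : Matrix (Fin 2) (Fin 2) (AdeleRing (𝓞 L) L)).map (adeleSnd L) = g.val := map_snd_ofFinite L 2 g
  -- components of the finite-adelic matrix
  have hover : ∀ w : PlacesOver L v, (g : Matrix (Fin 2) (Fin 2) (FiniteAdeleRing (𝓞 L) L)).map (AdelicGroupData.finiteAdeleEval L w.1) =
      ((localGLPiEquiv L 2 v (n : GL (Fin 2) (LocalRing L v)) w : GL (Fin 2) (w.1.adicCompletion L)) : Matrix (Fin 2) (Fin 2) (w.1.adicCompletion L)) := by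
    intro w
    rw [map_eval_eq_evalAt, hg, evalAt_inclPlace_of_over]
    rfl
  have hnot : ∀ q : HeightOneSpectrum (𝓞 L), q.under (𝓞 ↥(maximalRealSubfield L)) ≠ v →
      (g : Matrix (Fin 2) (Fin 2) (FiniteAdeleRing (𝓞 L) L)).map (AdelicGroupData.finiteAdeleEval L q) = 1 := by
    intro q hq
    rw [map_eval_eq_evalAt, hg, evalAt_inclPlace_of_not_over (↥(maximalRealSubfield L)) L (IsCMField.complexConj L) 2 _ hq u ⟨q, rfl⟩]
    rfl
  -- an entry of the adelic matrix vanishes / equals one as soon as the corresponding entry of `n` does, componentwise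
  have hentry : ∀ (i j : Fin 2) (a : LocalRing L v) (b : L), ((n : GL (Fin 2) (LocalRing L v)) : Matrix (Fin 2) (Fin 2) (LocalRing L v)) i j = a →
      a = algebraMap L (LocalRing L v) b → (1 : Matrix (Fin 2) (Fin 2) L) i j = b →
      ((GLn.ofFinite 2 L g : GL (Fin 2) (AdeleRing (𝓞 L) L)) : Matrix (Fin 2) (Fin 2) (AdeleRing (𝓞 L) L)) i j = algebraMap L (AdeleRing (𝓞 L) L) b := by
    intro i j a b hij ha hb
    refine Prod.ext ?_ ?_
    · have h1 := congrFun (congrFun hfst i) j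
      rw [Matrix.map_apply] at h1
      rw [show (((GLn.ofFinite 2 L g : GL (Fin 2) (AdeleRing (𝓞 L) L)) : Matrix (Fin 2) (Fin 2) (AdeleRing (𝓞 L) L)) i j).1 =
          adeleFst L (((GLn.ofFinite 2 L g : GL (Fin 2) (AdeleRing (𝓞 L) L)) : Matrix (Fin 2) (Fin 2) (AdeleRing (𝓞 L) L)) i j) from rfl,
        h1, ← Matrix.map_one (algebraMap L (InfiniteAdeleRing L)) (map_zero _) (map_one _), Matrix.map_apply, hb]
      rfl
    · have h2 := congrFun (congrFun hsnd i) j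
      rw [Matrix.map_apply] at h2
      rw [show (((GLn.ofFinite 2 L g : GL (Fin 2) (AdeleRing (𝓞 L) L)) : Matrix (Fin 2) (Fin 2) (AdeleRing (𝓞 L) L)) i j).2 =
          adeleSnd L (((GLn.ofFinite 2 L g : GL (Fin 2) (AdeleRing (𝓞 L) L)) : Matrix (Fin 2) (Fin 2) (AdeleRing (𝓞 L) L)) i j) from rfl,
        h2]
      refine FiniteAdeleRing.ext L fun q => ?_
      by_cases hq : q.under (𝓞 ↥(maximalRealSubfield L)) = v
      · have h3 := congrFun (congrFun (hover ⟨q, hq⟩) i) j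
        rw [Matrix.map_apply, AdelicGroupData.finiteAdeleEval_apply] at h3
        rw [h3, localGLPiEquiv_apply_apply, hij, ha]
        rfl
      · have h3 := congrFun (congrFun (hnot q hq) i) j
        rw [Matrix.map_apply, AdelicGroupData.finiteAdeleEval_apply] at h3
        rw [h3, ← Matrix.map_one (algebraMap L (q.adicCompletion L)) (map_zero _) (map_one _), Matrix.map_apply, hb]
        rfl
  rw [hM]
  refine ⟨fun i j hij => ?_, fun i => ?_⟩
  · rw [hentry i j 0 0 (htri hij) (map_zero _).symm (Matrix.one_apply_ne hij.ne'), map_zero]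
  · rw [hentry i i 1 1 (hdiag i) (map_one _).symm (Matrix.one_apply_eq i), map_one]

/-! ## §2 The Siegel radical is closed and abelian -/

/-- `N(𝔸_F)` is abelian, for every subgroup EQUAL to `adelicUnipotent F E c 2` (★ `mul_comm_adelicUnipotent_two`, transported by `subst`). [cite: Rogawski1990, §1.10] -/
theorem mul_comm_of_eq_adelicUnipotent {F E : Type} [Field F] [NumberField F] [Field E] [NumberField E] [Algebra F E] {c : E ≃ₐ[F] E}
    {Nsub : Subgroup (quasiSplit F E c 2).Adelic} (hN : Nsub = adelicUnipotent F E c 2) (a b : ↥Nsub) : a * b = b * a := by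
  subst hN
  exact mul_comm_adelicUnipotent_two a b

/-- The Siegel radical `U(J) ∩ (1 + 𝔫_1)` is abelian, for every `J` equal to `(StdForm.antidiagonal 2).over L`. [cite: Rogawski1990, §1.10] -/
theorem mul_comm_siegel {J : Matrix (Fin 2) (Fin 2) L} (hJ : (StdForm.antidiagonal 2).over L = J)
    (a b : ↥((standardUnipotentRadical 2 1 (AdeleRing (𝓞 L) L)).comap (adelicVal (↥(maximalRealSubfield L)) L (IsCMField.complexConj L) 2 J))) :
    a * b = b * a := by
  subst hJ
  exact mul_comm_of_eq_adelicUnipotent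
    (congrArg (Subgroup.comap (adelicVal (↥(maximalRealSubfield L)) L (IsCMField.complexConj L) 2 ((StdForm.antidiagonal 2).over L)))
      (upperUnitriangular_eq_standardUnipotentRadical_two (AdeleRing (𝓞 L) L)).symm) a b

/-- **The adelic Siegel radical `cmUnipotentRadical L 2 1` of `U(Φ₂)` is abelian.** [cite: Rogawski1990, §1.10] -/
theorem mul_comm_cmUnipotentRadical (a b : ↥(cmUnipotentRadical L 2 1)) : a * b = b * a :=
  mul_comm_siegel L (antidiagOne_eq_over (L := L) (N := 2)).symm a b

/-- **The adelic Siegel radical is closed** in `U(Φ₂)(𝔸_{L⁺})` (preimage of the closed upper unitriangular group of `GL₂(𝔸_L)`, ★ `isClosed_upperUnitriangular`).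
[cite: BorelJacquet1979, §4.4] -/
theorem isClosed_cmUnipotentRadical :
    IsClosed ((cmUnipotentRadical L 2 1 : Subgroup (cmDatum L 2 (Matrix.of fun i j : Fin 2 => if i.val + j.val + 1 = 2 then (1 : L) else 0)).Adelic) : Set (cmDatum L 2 (Matrix.of fun i j : Fin 2 => if i.val + j.val + 1 = 2 then (1 : L) else 0)).Adelic) := by
  haveI : T2Space (AdeleRing (𝓞 L) L) := t2Space_adeleRing L
  have hc : Continuous (adelicVal (↥(maximalRealSubfield L)) L (IsCMField.complexConj L) 2 (Matrix.of fun i j : Fin 2 => if i.val + j.val + 1 = 2 then (1 : L) else 0)) := continuous_subtype_val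
  have h := (isClosed_upperUnitriangular (n := 2) (R := AdeleRing (𝓞 L) L)).preimage hc
  rw [upperUnitriangular_eq_standardUnipotentRadical_two] at h
  exact h

/-! ## §3 (A) along the Siegel radical: the `v`-factor unfolding -/

-- one long composite proof (closed embedding, the iso `N_v ≃ₜ* H`, three measures, the unfolding): 4× the default per-declaration budget, measured.
set_option maxHeartbeats 800000 in
/-- **ADELIC CUSP-VANISHING OF THE PURE TENSOR ALONG THE SIEGEL RADICAL.**  `L` CM, `v` a finite place of `L⁺` NON-SPLIT in `L` (`hns`), `ρ` a smooth supercuspidal representation of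
`G_v = U(Φ₂)(L⁺_v)` with an invariant Hermitian form `B`, `u ∈ V`; `φ ∈ C_c(U(Φ₂)(𝔸_{L⁺}))` a pure tensor `φ(y) = Ψ_f(y) · B(ρ(y_v) u, u)` whose away-from-`v` factor `Ψ_f` does not
see the `v`-coordinate (★ p855494's shape).  Then for the Siegel radical `N = cmUnipotentRadical L 2 1` (any subgroup `Nrad` EQUAL to it, so that the consumer's binders
key the instances), every Haar measure `ν` on `↥N` and all `x, y`: **`∫_{N(𝔸)} φ(x n⁻¹ y) dν(n) = 0`.**  PROOF: `H := j_v(N_v) ≤ N(𝔸)` is closed (`j_v` is a closed embedding, ★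
`isClosedEmbedding_inclPlaceAdelic`; `j_v(N_v) ⊆ N(𝔸)` is §1) and `≅ N_v` as a topological group; `N(𝔸)` is abelian (§2), so `N(𝔸)/H` carries a non-zero invariant Radon measure (★
`exists_smulInvariantMeasure_isFiniteMeasureOnCompacts_quotient_of_comm`); along `H` the integrand is `Ψ_f(a b) · B(ρ(a_v n⁻¹ b_v) u, u)` (★ p855494 `awayFactor_mul_jhom_mul`,
`toLocal_mul_jhom_mul`), whose `N_v`-integral vanishes by the supercuspidality of `ρ` (★ `cm_integral_sesqForm_translate_inv_apply_cmBorelN_two_eq_zero`, K2E1-p08); ★ p855468 §1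
`integral_translate_inv_eq_zero_of_subgroup` unfolds `∫_N = ∫_{N/H} ∫_H = 0`. [cite: GelfandGraevPiatetskiShapiro1969, Ch. 1 §4] [cite: Gelbart1975, §10 p. 153] [cite: HarishChandra1970, Part I §3 p. 9]
[cite: BorelJacquet1979, §4.4] -/
theorem integral_translate_inv_eq_zero_siegel (hns : ∀ w : PlacesOver L v, IsCMField.complexConj L • w.1 = w.1)
    {V : Type*} [AddCommGroup V] [Module ℂ V] {ρ : Representation ℂ ((cmDatum L 2 (Matrix.of fun i j : Fin 2 => if i.val + j.val + 1 = 2 then (1 : L) else 0)).Local v) V} {B : V →ₗ⋆[ℂ] V →ₗ[ℂ] ℂ}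
    (hsm : ρ.IsSmooth) (hsc : ρ.IsSupercuspidal) (hBsymm : B.IsSymm) (hBinv : ∀ (g : (cmDatum L 2 (Matrix.of fun i j : Fin 2 => if i.val + j.val + 1 = 2 then (1 : L) else 0)).Local v) (x y : V), B (ρ g x) (ρ g y) = B x y) (u : V)
    (f : arch (↥(maximalRealSubfield L)) L (IsCMField.complexConj L) 2 (Matrix.of fun i j : Fin 2 => if i.val + j.val + 1 = 2 then (1 : L) else 0) → ℂ) (φ : CompactlySupportedContinuousMap (cmDatum L 2 (Matrix.of fun i j : Fin 2 => if i.val + j.val + 1 = 2 then (1 : L) else 0)).Adelic ℂ)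
    (hφ : ∀ y : (cmDatum L 2 (Matrix.of fun i j : Fin 2 => if i.val + j.val + 1 = 2 then (1 : L) else 0)).Adelic, φ y = (if ∀ w, w ≠ v → (cmDatum L 2 (Matrix.of fun i j : Fin 2 => if i.val + j.val + 1 = 2 then (1 : L) else 0)).toLocal w y ∈ cmLocalIntegralLevel L 2 (Matrix.of fun i j : Fin 2 => if i.val + j.val + 1 = 2 then (1 : L) else 0) w then
        f (UnitaryGroup.archPart (↥(maximalRealSubfield L)) L (IsCMField.complexConj L) 2 (Matrix.of fun i j : Fin 2 => if i.val + j.val + 1 = 2 then (1 : L) else 0) y) else 0) * B (ρ ((cmDatum L 2 (Matrix.of fun i j : Fin 2 => if i.val + j.val + 1 = 2 then (1 : L) else 0)).toLocal v y) u) u)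
    {Nrad : Subgroup (cmDatum L 2 (Matrix.of fun i j : Fin 2 => if i.val + j.val + 1 = 2 then (1 : L) else 0)).Adelic} (hNrad : Nrad = cmUnipotentRadical L 2 1)
    [MeasurableSpace ↥Nrad] [BorelSpace ↥Nrad] (νN : Measure ↥Nrad) [νN.IsHaarMeasure] (x y : (cmDatum L 2 (Matrix.of fun i j : Fin 2 => if i.val + j.val + 1 = 2 then (1 : L) else 0)).Adelic) :
    ∫ n, φ (x * ((n : ↥Nrad) : (cmDatum L 2 (Matrix.of fun i j : Fin 2 => if i.val + j.val + 1 = 2 then (1 : L) else 0)).Adelic)⁻¹ * y) ∂νN = 0 := by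
  subst hNrad
  set jv : (cmDatum L 2 (Matrix.of fun i j : Fin 2 => if i.val + j.val + 1 = 2 then (1 : L) else 0)).Local v →* (cmDatum L 2 (Matrix.of fun i j : Fin 2 => if i.val + j.val + 1 = 2 then (1 : L) else 0)).Adelic := (((MonoidHom.id ((cmDatum L 2 (Matrix.of fun i j : Fin 2 => if i.val + j.val + 1 = 2 then (1 : L) else 0)).Adelic)).comp ((inclPlaceAdelic (↥(maximalRealSubfield L)) L (IsCMField.complexConj L) 2 (Matrix.of fun i j : Fin 2 => if i.val + j.val + 1 = 2 then (1 : L) else 0) v).comp (localPiEquiv L (IsCMField.complexConj L) 2 (Matrix.of fun i j : Fin 2 => if i.val + j.val + 1 = 2 then (1 : L) else 0) v).symm.toMulEquiv.toMonoidHom)).comp (MonoidHom.id ((cmDatum L 2 (Matrix.of fun i j : Fin 2 => if i.val + j.val + 1 = 2 then (1 : L) else 0)).Local v))) with hjv_def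
  -- (1) closed objects
  have hNc := isClosed_cmUnipotentRadical L
  haveI : LocallyCompactSpace ↥(cmUnipotentRadical L 2 1) := hNc.isClosedEmbedding_subtypeVal.locallyCompactSpace
  haveI : SecondCountableTopology ↥(cmUnipotentRadical L 2 1) := TopologicalSpace.Subtype.secondCountableTopology _
  have hNv : IsClosed (((cmBorelTriple L 2 v).N : Subgroup ↥(unitaryGroupOfForm (conjLocal L (IsCMField.complexConj L) v) (cmLocalForm L 2 v))) :
      Set ↥(unitaryGroupOfForm (conjLocal L (IsCMField.complexConj L) v) (cmLocalForm L 2 v))) := isClosed_coe_cmBorelTriple_N L 2 v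
  have hjv_emb : IsClosedEmbedding jv :=
    (isClosedEmbedding_inclPlaceAdelic (↥(maximalRealSubfield L)) L (IsCMField.complexConj L) 2 (Matrix.of fun i j : Fin 2 => if i.val + j.val + 1 = 2 then (1 : L) else 0) v).comp
      (localPiEquiv L (IsCMField.complexConj L) 2 (Matrix.of fun i j : Fin 2 => if i.val + j.val + 1 = 2 then (1 : L) else 0) v).symm.toHomeomorph.isClosedEmbedding
  -- (2) `H := j_v(N_v)` as a subgroup of `N(𝔸)`
  set H : Subgroup ↥(cmUnipotentRadical L 2 1) := (((cmBorelTriple L 2 v).N).map jv).subgroupOf (cmUnipotentRadical L 2 1) with hH_def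
  have hHmem : ∀ {z : ↥(cmUnipotentRadical L 2 1)}, z ∈ H ↔ ∃ n ∈ (cmBorelTriple L 2 v).N, jv n = (z : (cmDatum L 2 (Matrix.of fun i j : Fin 2 => if i.val + j.val + 1 = 2 then (1 : L) else 0)).Adelic) :=
    fun {z} => Subgroup.mem_subgroupOf.trans Subgroup.mem_map
  have hHset : (H : Set ↥(cmUnipotentRadical L 2 1)) =
      Subtype.val ⁻¹' (jv '' (((cmBorelTriple L 2 v).N : Subgroup _) : Set ↥(unitaryGroupOfForm (conjLocal L (IsCMField.complexConj L) v) (cmLocalForm L 2 v)))) := by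
    ext z
    simp only [SetLike.mem_coe, hHmem, Set.mem_preimage, Set.mem_image]
    exact Iff.rfl
  haveI hHc : IsClosed (H : Set ↥(cmUnipotentRadical L 2 1)) := by
    rw [hHset]
    exact (hjv_emb.isClosedMap _ hNv).preimage continuous_subtype_val
  -- (3) `e : N_v ≃ₜ* H`
  have hmemN : ∀ n : ↥((cmBorelTriple L 2 v).N), jv (n : ↥(unitaryGroupOfForm (conjLocal L (IsCMField.complexConj L) v) (cmLocalForm L 2 v))) ∈ cmUnipotentRadical L 2 1 := fun n => jhom_mem_cmUnipotentRadical L v n n.2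
  have hmemH : ∀ n : ↥((cmBorelTriple L 2 v).N), (⟨jv (n : ↥(unitaryGroupOfForm (conjLocal L (IsCMField.complexConj L) v) (cmLocalForm L 2 v))), hmemN n⟩ : ↥(cmUnipotentRadical L 2 1)) ∈ H := fun n => hHmem.2 ⟨n, n.2, rfl⟩
  let eH : ↥((cmBorelTriple L 2 v).N) →* ↥H :=
    { toFun := fun n => ⟨⟨jv (n : ↥(unitaryGroupOfForm (conjLocal L (IsCMField.complexConj L) v) (cmLocalForm L 2 v))), hmemN n⟩, hmemH n⟩
      map_one' := Subtype.ext (Subtype.ext (by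
        change jv ((1 : ↥((cmBorelTriple L 2 v).N)) : ↥(unitaryGroupOfForm (conjLocal L (IsCMField.complexConj L) v) (cmLocalForm L 2 v))) = 1
        rw [OneMemClass.coe_one]
        exact map_one jv))
      map_mul' := fun a b => Subtype.ext (Subtype.ext (by
        change jv ((a : ↥(unitaryGroupOfForm (conjLocal L (IsCMField.complexConj L) v) (cmLocalForm L 2 v))) * (b : ↥(unitaryGroupOfForm (conjLocal L (IsCMField.complexConj L) v) (cmLocalForm L 2 v)))) = jv (a : ↥(unitaryGroupOfForm (conjLocal L (IsCMField.complexConj L) v) (cmLocalForm L 2 v))) * jv (b : ↥(unitaryGroupOfForm (conjLocal L (IsCMField.complexConj L) v) (cmLocalForm L 2 v)))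
        exact map_mul jv _ _)) }
  have heH_apply : ∀ n : ↥((cmBorelTriple L 2 v).N), (((eH n : ↥H) : ↥(cmUnipotentRadical L 2 1)) : (cmDatum L 2 (Matrix.of fun i j : Fin 2 => if i.val + j.val + 1 = 2 then (1 : L) else 0)).Adelic) = jv (n : ↥(unitaryGroupOfForm (conjLocal L (IsCMField.complexConj L) v) (cmLocalForm L 2 v))) := fun _ => rfl
  have heH_inj : Function.Injective eH := fun a b h =>
    Subtype.ext (hjv_emb.injective (by rw [← heH_apply, ← heH_apply, h]))
  have heH_surj : Function.Surjective eH := fun z => by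
    obtain ⟨n, hn, hz⟩ := hHmem.1 z.2
    exact ⟨⟨n, hn⟩, Subtype.ext (Subtype.ext hz)⟩
  have heH_cont : Continuous eH :=
    ((hjv_emb.continuous.comp continuous_subtype_val).subtype_mk _).subtype_mk _
  let e₀ : ↥((cmBorelTriple L 2 v).N) ≃* ↥H := MulEquiv.ofBijective eH ⟨heH_inj, heH_surj⟩
  have he₀symm : Continuous e₀.symm := by
    have hι : IsEmbedding (fun n : ↥((cmBorelTriple L 2 v).N) => jv (n : ↥(unitaryGroupOfForm (conjLocal L (IsCMField.complexConj L) v) (cmLocalForm L 2 v)))) := hjv_emb.isEmbedding.comp IsEmbedding.subtypeVal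
    rw [hι.continuous_iff]
    have hcomp : (fun n : ↥((cmBorelTriple L 2 v).N) => jv (n : ↥(unitaryGroupOfForm (conjLocal L (IsCMField.complexConj L) v) (cmLocalForm L 2 v)))) ∘ e₀.symm = fun z : ↥H => ((z : ↥(cmUnipotentRadical L 2 1)) : (cmDatum L 2 (Matrix.of fun i j : Fin 2 => if i.val + j.val + 1 = 2 then (1 : L) else 0)).Adelic) := by
      funext z
      change (((eH (e₀.symm z) : ↥H) : ↥(cmUnipotentRadical L 2 1)) : (cmDatum L 2 (Matrix.of fun i j : Fin 2 => if i.val + j.val + 1 = 2 then (1 : L) else 0)).Adelic) = _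
      rw [show eH (e₀.symm z) = e₀ (e₀.symm z) from rfl, e₀.apply_symm_apply]
    rw [hcomp]
    exact continuous_subtype_val.comp continuous_subtype_val
  let e : ↥((cmBorelTriple L 2 v).N) ≃ₜ* ↥H := { e₀ with continuous_toFun := heH_cont, continuous_invFun := he₀symm }
  have he_apply : ∀ n : ↥((cmBorelTriple L 2 v).N), (((e n : ↥H) : ↥(cmUnipotentRadical L 2 1)) : (cmDatum L 2 (Matrix.of fun i j : Fin 2 => if i.val + j.val + 1 = 2 then (1 : L) else 0)).Adelic) = jv (n : ↥(unitaryGroupOfForm (conjLocal L (IsCMField.complexConj L) v) (cmLocalForm L 2 v))) := fun _ => rfl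
  -- (4) measures: the push-forward of a Haar measure of `N_v` to `H`, an invariant Radon measure on `N(𝔸)/H`
  letI : MeasurableSpace ↥((cmBorelTriple L 2 v).N) := borel _
  haveI : BorelSpace ↥((cmBorelTriple L 2 v).N) := ⟨rfl⟩
  haveI : LocallyCompactSpace ↥(unitaryGroupOfForm (conjLocal L (IsCMField.complexConj L) v) (cmLocalForm L 2 v)) := inferInstanceAs (LocallyCompactSpace ↥(«local» L (IsCMField.complexConj L) 2 (Matrix.of fun i j : Fin 2 => if i.val + j.val + 1 = 2 then (1 : L) else 0) v))
  haveI : LocallyCompactSpace ↥((cmBorelTriple L 2 v).N) := hNv.isClosedEmbedding_subtypeVal.locallyCompactSpace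
  haveI : LocallyCompactSpace ↥H := hHc.isClosedEmbedding_subtypeVal.locallyCompactSpace
  haveI : SecondCountableTopology ↥H := TopologicalSpace.Subtype.secondCountableTopology _
  obtain ⟨νv, hνv⟩ : ∃ νv : Measure ↥((cmBorelTriple L 2 v).N), νv.IsHaarMeasure := ⟨Measure.haar, inferInstance⟩
  haveI : IsFiniteMeasureOnCompacts νv := inferInstance
  haveI : νv.IsMulLeftInvariant := inferInstance
  obtain ⟨ρH, hρH_def⟩ : ∃ ρH : Measure ↥H, ρH = Measure.map e νv := ⟨_, rfl⟩
  haveI : ρH.IsHaarMeasure := by rw [hρH_def]; infer_instance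
  have hρH0 : ρH ≠ 0 := fun h =>
    (isOpen_univ.measure_pos ρH Set.univ_nonempty).ne' (by rw [h, Measure.coe_zero, Pi.zero_apply])
  letI : MeasurableSpace (↥(cmUnipotentRadical L 2 1) ⧸ H) := borel _
  haveI : BorelSpace (↥(cmUnipotentRadical L 2 1) ⧸ H) := ⟨rfl⟩
  have hcommN : ∀ a b : ↥(cmUnipotentRadical L 2 1), a * b = b * a := mul_comm_cmUnipotentRadical L
  haveI : νN.IsMulRightInvariant := by
    refine ⟨fun g => ?_⟩
    have hfun : (fun a : ↥(cmUnipotentRadical L 2 1) => a * g) = (fun a => g * a) := funext fun a => hcommN a g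
    rw [hfun]
    exact MeasureTheory.map_mul_left_eq_self νN g
  obtain ⟨μq, hμq_inv, hμq_fin, hμq0⟩ :=
    Literature.MeasureTheory.Group.exists_smulInvariantMeasure_isFiniteMeasureOnCompacts_quotient_of_comm H hHc (fun a _ b _ => hcommN a b) νN
  haveI := hμq_inv
  haveI := hμq_fin
  -- (5) the `H`-periods vanish
  have hme : MeasurableEmbedding (e : ↥((cmBorelTriple L 2 v).N) → ↥H) := e.toHomeomorph.measurableEmbedding
  have hloc : ∀ a b : (cmDatum L 2 (Matrix.of fun i j : Fin 2 => if i.val + j.val + 1 = 2 then (1 : L) else 0)).Adelic,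
      ∫ h : ↥H, φ (a * (((h : ↥(cmUnipotentRadical L 2 1)) : (cmDatum L 2 (Matrix.of fun i j : Fin 2 => if i.val + j.val + 1 = 2 then (1 : L) else 0)).Adelic))⁻¹ * b) ∂ρH = 0 := by
    intro a b
    rw [hρH_def, hme.integral_map]
    have hint : ∀ n : ↥((cmBorelTriple L 2 v).N), φ (a * (((e n : ↥H) : ↥(cmUnipotentRadical L 2 1)) : (cmDatum L 2 (Matrix.of fun i j : Fin 2 => if i.val + j.val + 1 = 2 then (1 : L) else 0)).Adelic)⁻¹ * b) =
        (if ∀ w, w ≠ v → (cmDatum L 2 (Matrix.of fun i j : Fin 2 => if i.val + j.val + 1 = 2 then (1 : L) else 0)).toLocal w (a * b) ∈ cmLocalIntegralLevel L 2 (Matrix.of fun i j : Fin 2 => if i.val + j.val + 1 = 2 then (1 : L) else 0) w then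
          f (UnitaryGroup.archPart (↥(maximalRealSubfield L)) L (IsCMField.complexConj L) 2 (Matrix.of fun i j : Fin 2 => if i.val + j.val + 1 = 2 then (1 : L) else 0) (a * b)) else 0) *
          B (ρ ((cmDatum L 2 (Matrix.of fun i j : Fin 2 => if i.val + j.val + 1 = 2 then (1 : L) else 0)).toLocal v a * @Inv.inv ((cmDatum L 2 (Matrix.of fun i j : Fin 2 => if i.val + j.val + 1 = 2 then (1 : L) else 0)).Local v) _ (n : ↥(unitaryGroupOfForm (conjLocal L (IsCMField.complexConj L) v) (cmLocalForm L 2 v))) * (cmDatum L 2 (Matrix.of fun i j : Fin 2 => if i.val + j.val + 1 = 2 then (1 : L) else 0)).toLocal v b) u) u := by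
      intro n
      rw [he_apply, ← map_inv, hφ, hjv_def, K2E1PoincareSeriesH1PackagePoincare.awayFactor_mul_jhom_mul,
        K2E1PoincareSeriesH1PackagePoincare.toLocal_mul_jhom_mul]
    simp_rw [hint]
    rw [integral_const_mul]
    have h0 := K2E1SupercuspidalUnipotentPeriodVanishing.cm_integral_sesqForm_translate_inv_apply_cmBorelN_two_eq_zero L v hns
      νv ρ hsm hsc hBsymm hBinv ((cmDatum L 2 (Matrix.of fun i j : Fin 2 => if i.val + j.val + 1 = 2 then (1 : L) else 0)).toLocal v a) ((cmDatum L 2 (Matrix.of fun i j : Fin 2 => if i.val + j.val + 1 = 2 then (1 : L) else 0)).toLocal v b) u u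
    exact mul_eq_zero_of_right _ h0
  -- (6) unfold `∫_N = ∫_{N/H} ∫_H`
  exact K2E1PoincareSeriesCuspidalGlueU2.integral_translate_inv_eq_zero_of_subgroup (cmUnipotentRadical L 2 1) H ρH μq hNc hμq0 hρH0
    φ.continuous φ.hasCompactSupport hloc νN x y

/-! ## §4 (A) of ★ p855563 at `𝔓 := cmParabolicData L 2`, binder for binder -/

/-- **(A) OF ★ p855563 FOR `U(Φ₂)` AT A NON-SPLIT `v`: THE PURE TENSOR `c_u ⊗ 𝟙_{K^v} ⊗ f` IS ADELICALLY CUSPIDAL ALONG THE SIEGEL RADICAL.**  The hypothesis `hA` of ★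
`K2E1GlobaliseSupercuspidalU2Poincare.globaliseSupercuspidal_of_poincare` at `Φ := Φ₂`, `𝔓 := cmParabolicData L 2` (one index: the Siegel radical), token for token, from §3 —
given that `v` is non-split in `L` (`hns`), `ρ` smooth supercuspidal with invariant Hermitian `B`. [cite: GelfandGraevPiatetskiShapiro1969, Ch. 1 §4] [cite: Gelbart1975, §10 p. 153]
[cite: HarishChandra1970, Part I §3 p. 9] -/
theorem adelicCuspVanishing_cmParabolicData_two (hns : ∀ w : PlacesOver L v, IsCMField.complexConj L • w.1 = w.1)
    {V : Type*} [AddCommGroup V] [Module ℂ V] {ρ : Representation ℂ ((cmDatum L 2 (Matrix.of fun i j : Fin 2 => if i.val + j.val + 1 = 2 then (1 : L) else 0)).Local v) V} {B : V →ₗ⋆[ℂ] V →ₗ[ℂ] ℂ}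
    (hsm : ρ.IsSmooth) (hsc : ρ.IsSupercuspidal) (hBsymm : B.IsSymm) (hBinv : ∀ (g : (cmDatum L 2 (Matrix.of fun i j : Fin 2 => if i.val + j.val + 1 = 2 then (1 : L) else 0)).Local v) (x y : V), B (ρ g x) (ρ g y) = B x y) (u : V) :
    ∀ (f : arch (↥(maximalRealSubfield L)) L (IsCMField.complexConj L) 2 (Matrix.of fun i j : Fin 2 => if i.val + j.val + 1 = 2 then (1 : L) else 0) → ℂ) (φ : CompactlySupportedContinuousMap (cmDatum L 2 (Matrix.of fun i j : Fin 2 => if i.val + j.val + 1 = 2 then (1 : L) else 0)).Adelic ℂ),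
      (∀ y : (cmDatum L 2 (Matrix.of fun i j : Fin 2 => if i.val + j.val + 1 = 2 then (1 : L) else 0)).Adelic, φ y = (if ∀ w, w ≠ v → (cmDatum L 2 (Matrix.of fun i j : Fin 2 => if i.val + j.val + 1 = 2 then (1 : L) else 0)).toLocal w y ∈ cmLocalIntegralLevel L 2 (Matrix.of fun i j : Fin 2 => if i.val + j.val + 1 = 2 then (1 : L) else 0) w then
          f (UnitaryGroup.archPart (↥(maximalRealSubfield L)) L (IsCMField.complexConj L) 2 (Matrix.of fun i j : Fin 2 => if i.val + j.val + 1 = 2 then (1 : L) else 0) y) else 0) * B (ρ ((cmDatum L 2 (Matrix.of fun i j : Fin 2 => if i.val + j.val + 1 = 2 then (1 : L) else 0)).toLocal v y) u) u) →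
      ∀ (i : (cmParabolicData L 2).ι) [MeasurableSpace ((cmParabolicData L 2).radical i)] [BorelSpace ((cmParabolicData L 2).radical i)]
        (νN : Measure ((cmParabolicData L 2).radical i)) [νN.IsHaarMeasure] (x y : (cmDatum L 2 (Matrix.of fun i j : Fin 2 => if i.val + j.val + 1 = 2 then (1 : L) else 0)).Adelic),
        ∫ n, φ (x * ((n : (cmParabolicData L 2).radical i) : (cmDatum L 2 (Matrix.of fun i j : Fin 2 => if i.val + j.val + 1 = 2 then (1 : L) else 0)).Adelic)⁻¹ * y) ∂νN = 0 := by
  intro f φ hφ i _ _ νN _ x y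
  obtain ⟨k, hk⟩ := i
  obtain rfl : k = 1 := by omega
  exact integral_translate_inv_eq_zero_siegel L v hns hsm hsc hBsymm hBinv u f φ hφ (Nrad := (cmParabolicData L 2).radical ⟨1, hk⟩) rfl νN x y

end PlaceFactor

end Summit.HodgeConjecture.HodgeConjecture.Cruxes.H413.K2E1SiegelRadicalPlaceFactorU2
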